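import Literature.MathematicalPhysics.QuantumLattice.Z2GaugeHiggsTorus
import Literature.Analysis.Matrix.ExponentialScalarSquare
import Mathlib.Analysis.Normed.Algebra.MatrixExponential
import Mathlib.Analysis.Complex.Trigonometric
import HarnessLib

/-!
# NEG-hPcol piece (N2c): the commutant of two distinct Pauli matrices — and of two Pauli exponentials — is the scalars

Cell `ym3-torus` (YM ladder rung R3 = continuum `SU(2)` Yang–Mills on T³ — a RUNG, NOT d = 4, NOT infinite volume, NOT a mass gap,
NOT Clay).  Width seat px15 g8; piece (N2c) of px12 g11's NEG-hPcol plan (★★OWNER WORD 38 «GO, LOW PRIORITY»; naming line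
2026-08-29T18:30:32Z): the kernel certificate that the PRE-Lift S42ᴸ display row `hPcol` is not inhabitable uses an explicit
one-parameter family `U_s(x, μ) = exp(i·s·θ(x_μ)·σ_μ)`; its irreducibility step (N5, px12) needs that a `2 × 2` matrix commuting with
two Pauli exponentials `e_μ(a) = exp(i a σ_μ)`, `e_ν(b) = exp(i b σ_ν)` along DISTINCT axes `μ ≠ ν`, at angles with `sin a ≠ 0`,
`sin b ≠ 0`, is a scalar.  This file is that `M₂(ℂ)` algebra and nothing else (def-free, `--supports stmt-QuantumFields-19200 --as helper`):

* §1 `entries_of_commute_pauli_zero/one/two` — the entry relations forced by commuting with `σˣ`, `σʸ`, `σᶻ`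
  (`spinHalfPauli 0/1/2` of `Literature.MathematicalPhysics.QuantumLattice.SpinOperators`);
  ★ `eq_smul_one_of_commute_pauli_pair` — `μ ≠ ν → Y σ_μ = σ_μ Y → Y σ_ν = σ_ν Y → ∃ z, Y = z • 1`.
* §2 `commute_of_commute_smul_one_add_smul` — commuting with `c • 1 + d • σ`, `d ≠ 0`, is commuting with `σ` (any square size);
  `exp_I_smul_real_smul_of_mul_self_eq_one` — EULER'S FORMULA for an involution: `σ * σ = 1 ⇒ exp(i t σ) = cos t • 1 + (i sin t) • σ`
  (from the tree's `Literature.Analysis.Matrix.exp_smul_of_mul_self_eq_smul_one`, the scalar-square exponential); its Pauli instance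
  `σ = spinHalfPauli μ` (`spinHalfPauli_mul_self`) is used inline — the NAMED Pauli form is piece (N2a)'s `Prop7HPcolNegPauliExp.exp_I_smul_pauli` (px6 g11);
  ★ `eq_smul_one_of_commute_exp_pauli_pair` — `μ ≠ ν → sin a ≠ 0 → sin b ≠ 0 → Y e_μ(a) = e_μ(a) Y → Y e_ν(b) = e_ν(b) Y → ∃ z, Y = z • 1`,
  with `e_μ(t)` spelled out literally as `NormedSpace.exp (Complex.I • ((t : ℂ) • spinHalfPauli μ))` (no notation).

HONEST SCOPE: `2 × 2` matrix algebra; `hPcol` is a display BINDER of the EX lane (route UnitScaleTilt, item stmt-QuantumFields-19200) —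
this is negative knowledge of record for TARGET footnote 17v, NOT an item refutation, NOT progress on EX; nothing of EX ∕ 19200 ∕ the rung is
proved here; the Yang–Mills mass gap is NOT proved.

References: any quantum-mechanics text for `e^{iθ n·σ} = cos θ + i sin θ n·σ` and the irreducibility of the Pauli matrices (Schur);
H. Tasaki, *Physics and Mathematics of Quantum Many-Body Systems* (2020) §2.1 (2.1.8) [Tasaki2020]; T. Bałaban, CMP 102 (1985)
[Balaban1985Variational] for the EX-lane context only.
-/

noncomputable section

namespace Summit.QuantumFields.YangMills.Theorems.Prop7HPcolNegPauliCommutant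

open Literature.MathematicalPhysics.QuantumLattice (spinHalfPauli)
open Literature.MathematicalPhysics.QuantumLattice.Z2GaugeHiggs (spinHalfPauli_mul_self)
open NormedSpace

open scoped Matrix.Norms.L2Operator

/-! ## §1 The commutant of two distinct Pauli matrices -/

/-- Commuting with `σˣ = !![0, 1; 1, 0]` forces `Y₀₁ = Y₁₀` and `Y₀₀ = Y₁₁`. [cite: Tasaki2020, §2.1 (2.1.8)] -/
theorem entries_of_commute_pauli_zero {Y : Matrix (Fin 2) (Fin 2) ℂ} (h : Y * spinHalfPauli 0 = spinHalfPauli 0 * Y) :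
    Y 0 1 = Y 1 0 ∧ Y 0 0 = Y 1 1 := by
  have h00 := congrFun (congrFun h 0) 0
  have h01 := congrFun (congrFun h 0) 1
  simp [spinHalfPauli, Matrix.mul_apply, Fin.sum_univ_two] at h00 h01
  exact ⟨h00, h01⟩

/-- Commuting with `σʸ = !![0, -i; i, 0]` forces `Y₀₁ = -Y₁₀` and `Y₀₀ = Y₁₁`. [cite: Tasaki2020, §2.1 (2.1.8)] -/
theorem entries_of_commute_pauli_one {Y : Matrix (Fin 2) (Fin 2) ℂ} (h : Y * spinHalfPauli 1 = spinHalfPauli 1 * Y) :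
    Y 0 1 = -Y 1 0 ∧ Y 0 0 = Y 1 1 := by
  have h00 := congrFun (congrFun h 0) 0
  have h01 := congrFun (congrFun h 0) 1
  simp [spinHalfPauli, Matrix.mul_apply, Fin.sum_univ_two] at h00 h01
  refine ⟨?_, ?_⟩
  · have : Complex.I * Y 0 1 = Complex.I * (-Y 1 0) := by linear_combination h00
    exact mul_left_cancel₀ Complex.I_ne_zero this
  · have : Complex.I * Y 0 0 = Complex.I * Y 1 1 := by linear_combination h01
    exact mul_left_cancel₀ Complex.I_ne_zero this

/-- Commuting with `σᶻ = !![1, 0; 0, -1]` forces `Y₀₁ = 0` and `Y₁₀ = 0`. [cite: Tasaki2020, §2.1 (2.1.8)] -/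
theorem entries_of_commute_pauli_two {Y : Matrix (Fin 2) (Fin 2) ℂ} (h : Y * spinHalfPauli 2 = spinHalfPauli 2 * Y) :
    Y 0 1 = 0 ∧ Y 1 0 = 0 := by
  have h01 := congrFun (congrFun h 0) 1
  have h10 := congrFun (congrFun h 1) 0
  simp [spinHalfPauli, Matrix.mul_apply, Fin.sum_univ_two] at h01 h10
  refine ⟨?_, ?_⟩
  · have : (2 : ℂ) * Y 0 1 = 0 := by linear_combination -h01
    simpa using this
  · have : (2 : ℂ) * Y 1 0 = 0 := by linear_combination h10
    simpa using this

/-- A `2 × 2` matrix with equal diagonal entries and vanishing off-diagonal entries is a scalar. [folklore] -/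
theorem exists_eq_smul_one_of_entries {Y : Matrix (Fin 2) (Fin 2) ℂ} (hd : Y 0 0 = Y 1 1) (h01 : Y 0 1 = 0) (h10 : Y 1 0 = 0) :
    ∃ z : ℂ, Y = z • (1 : Matrix (Fin 2) (Fin 2) ℂ) := by
  refine ⟨Y 0 0, ?_⟩
  ext i j
  fin_cases i <;> fin_cases j <;> simp [hd, h01, h10]

/-- ★ **THE COMMUTANT OF TWO DISTINCT PAULI MATRICES IS THE SCALARS**: if `μ ≠ ν` and `Y ∈ M₂(ℂ)` commutes with `σ_μ` and with `σ_ν`,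
then `Y = z • 1` for some `z : ℂ` (the Pauli pair generates the irreducible algebra `M₂(ℂ)`; here by entries).
[cite: Tasaki2020, §2.1 (2.1.8)] -/
theorem eq_smul_one_of_commute_pauli_pair {μ ν : Fin 3} (hμν : μ ≠ ν) {Y : Matrix (Fin 2) (Fin 2) ℂ}
    (hμ : Y * spinHalfPauli μ = spinHalfPauli μ * Y) (hν : Y * spinHalfPauli ν = spinHalfPauli ν * Y) :
    ∃ z : ℂ, Y = z • (1 : Matrix (Fin 2) (Fin 2) ℂ) := by
  fin_cases μ <;> fin_cases ν
  · exact absurd rfl hμν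
  · obtain ⟨h1, hd⟩ := entries_of_commute_pauli_zero hμ
    obtain ⟨h2, -⟩ := entries_of_commute_pauli_one hν
    have h01 : Y 0 1 = 0 := by linear_combination (h1 + h2) / 2
    have h10 : Y 1 0 = 0 := by linear_combination (h2 - h1) / 2
    exact exists_eq_smul_one_of_entries hd h01 h10
  · obtain ⟨-, hd⟩ := entries_of_commute_pauli_zero hμ
    obtain ⟨h01, h10⟩ := entries_of_commute_pauli_two hν
    exact exists_eq_smul_one_of_entries hd h01 h10
  · obtain ⟨h2, hd⟩ := entries_of_commute_pauli_one hμ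
    obtain ⟨h1, -⟩ := entries_of_commute_pauli_zero hν
    have h01 : Y 0 1 = 0 := by linear_combination (h1 + h2) / 2
    have h10 : Y 1 0 = 0 := by linear_combination (h2 - h1) / 2
    exact exists_eq_smul_one_of_entries hd h01 h10
  · exact absurd rfl hμν
  · obtain ⟨-, hd⟩ := entries_of_commute_pauli_one hμ
    obtain ⟨h01, h10⟩ := entries_of_commute_pauli_two hν
    exact exists_eq_smul_one_of_entries hd h01 h10
  · obtain ⟨h01, h10⟩ := entries_of_commute_pauli_two hμ
    obtain ⟨-, hd⟩ := entries_of_commute_pauli_zero hν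
    exact exists_eq_smul_one_of_entries hd h01 h10
  · obtain ⟨h01, h10⟩ := entries_of_commute_pauli_two hμ
    obtain ⟨-, hd⟩ := entries_of_commute_pauli_one hν
    exact exists_eq_smul_one_of_entries hd h01 h10
  · exact absurd rfl hμν

/-! ## §2 The same for the Pauli exponentials `exp(i t σ_μ) = cos t • 1 + (i sin t) • σ_μ` -/

/-- Commuting with `c • 1 + d • σ` for `d ≠ 0` is the same as commuting with `σ` (any square size). [folklore] -/
theorem commute_of_commute_smul_one_add_smul {n : Type*} [Fintype n] [DecidableEq n] {σ Y : Matrix n n ℂ} {c d : ℂ}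
    (hd : d ≠ 0) (h : Y * (c • (1 : Matrix n n ℂ) + d • σ) = (c • (1 : Matrix n n ℂ) + d • σ) * Y) :
    Y * σ = σ * Y := by
  rw [mul_add, add_mul, mul_smul_comm, smul_mul_assoc, mul_one, one_mul, add_right_inj, mul_smul_comm, smul_mul_assoc] at h
  exact (smul_right_inj hd).1 h

/-- **EULER'S FORMULA FOR AN INVOLUTION**: if `σ * σ = 1` in `M₂(ℂ)` then for every real `t`,
`exp(i t σ) = cos t • 1 + (i sin t) • σ` — the scalar-square exponential `Literature.Analysis.Matrix.exp_smul_of_mul_self_eq_smul_one`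
at `E = 1`, scalar `i t`, read through `cosh(i t) = cos t`, `sinh(i t) = i sin t`. [folklore] -/
theorem exp_I_smul_real_smul_of_mul_self_eq_one {σ : Matrix (Fin 2) (Fin 2) ℂ} (hσ : σ * σ = 1) (t : ℝ) :
    exp (Complex.I • ((t : ℂ) • σ)) = (Real.cos t : ℂ) • (1 : Matrix (Fin 2) (Fin 2) ℂ) + (Complex.I * Real.sin t) • σ := by
  have hx : σ * σ = ((1 : ℂ) ^ 2) • (1 : Matrix (Fin 2) (Fin 2) ℂ) := by rw [hσ, one_pow, one_smul]
  rw [smul_smul, Literature.Analysis.Matrix.exp_smul_of_mul_self_eq_smul_one hx one_ne_zero, mul_one, div_one,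
    mul_comm Complex.I, Complex.cosh_mul_I, Complex.sinh_mul_I, Complex.ofReal_cos, Complex.ofReal_sin, mul_comm (Complex.sin _)]

/-- Commuting with the Pauli exponential `exp(i t σ_μ)` at an angle with `sin t ≠ 0` is commuting with `σ_μ`. [folklore] -/
theorem commute_pauli_of_commute_exp {μ : Fin 3} {t : ℝ} (ht : Real.sin t ≠ 0) {Y : Matrix (Fin 2) (Fin 2) ℂ}
    (h : Y * exp (Complex.I • ((t : ℂ) • spinHalfPauli μ)) = exp (Complex.I • ((t : ℂ) • spinHalfPauli μ)) * Y) :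
    Y * spinHalfPauli μ = spinHalfPauli μ * Y := by
  rw [exp_I_smul_real_smul_of_mul_self_eq_one (spinHalfPauli_mul_self μ)] at h
  exact commute_of_commute_smul_one_add_smul (mul_ne_zero Complex.I_ne_zero (Complex.ofReal_ne_zero.2 ht)) h

/-- ★ **THE COMMUTANT OF TWO PAULI EXPONENTIALS ALONG DISTINCT AXES IS THE SCALARS**: for `μ ≠ ν`, angles with `sin a ≠ 0`, `sin b ≠ 0`,
every `Y ∈ M₂(ℂ)` commuting with `e_μ(a) = exp(i a σ_μ)` and with `e_ν(b) = exp(i b σ_ν)` is `z • 1` — via Euler's formula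
`e_μ(t) = cos t • 1 + (i sin t) • σ_μ` (§2 at `σ_μ² = 1`), commuting with `e_μ(a)` at `sin a ≠ 0` is commuting with `σ_μ`, then §1.  The exponential is spelled
out literally (`NormedSpace.exp (Complex.I • ((t : ℂ) • spinHalfPauli μ))`, the matrix of `Prop7TPrint.expHerm ((t : ℂ) • spinHalfPauli μ)` by
`coe_expHerm`).  [cite: Tasaki2020, §2.1 (2.1.8)] -/
theorem eq_smul_one_of_commute_exp_pauli_pair {μ ν : Fin 3} (hμν : μ ≠ ν) {a b : ℝ} (ha : Real.sin a ≠ 0) (hb : Real.sin b ≠ 0)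
    {Y : Matrix (Fin 2) (Fin 2) ℂ}
    (hμ : Y * exp (Complex.I • ((a : ℂ) • spinHalfPauli μ)) = exp (Complex.I • ((a : ℂ) • spinHalfPauli μ)) * Y)
    (hν : Y * exp (Complex.I • ((b : ℂ) • spinHalfPauli ν)) = exp (Complex.I • ((b : ℂ) • spinHalfPauli ν)) * Y) :
    ∃ z : ℂ, Y = z • (1 : Matrix (Fin 2) (Fin 2) ℂ) :=
  eq_smul_one_of_commute_pauli_pair hμν (commute_pauli_of_commute_exp ha hμ) (commute_pauli_of_commute_exp hb hν)

end Summit.QuantumFields.YangMills.Theorems.Prop7HPcolNegPauliCommutant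

end
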